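import Mathlib
import HarnessLib
import Summits.NavierStokesRegularity.NavierStokesRegularity.Theorems.TaylorModelRungThreeReadoutVCrossingWinP
import Summits.NavierStokesRegularity.NavierStokesRegularity.Theorems.TaylorModelRungThreeReadoutVLandTools

/-!
# Line `taylor-model` on crux K1b-DR (stmt-NavierStokesRegularity-23954) — G-side tools for the POINCARÉ-CORRECTED base landing
# (`ReadoutsVP`): segments of `NodeStart 0` states, the crossing of a hull start in the last sub-step, the centre's crossing
# (ns-tm-g4 g7)

Inputs of the mean-value proof of the base landing (`…ReadoutVLandBaseWinP.baseLanding_ofVP`, design: tm-g4 g6 memo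
`WINDOWED-READOUTS-23954.md` §R9p):

* `segment_mem_hull1` — the segment from the centre `x_{S−1}` to a `NodeStart 0` state lies in the level-1 hull box
  (`Cm` linear, `rPl 0 ≤ rPl 1`);
* `lastStep_crossingP` — a trajectory of the last sub-step started in the level-1 hull box `H¹_{S−1}` crosses the section
  exactly once, at the least time of `[0,h]` where `σf ≥ lev`, which lies in the LEVEL-1 window `[ulo 1, uhi 1]`, with crossing
  state in `Z¹` ((F1′); (R0e) the section functional as a continuous linear map; (R6)/(R7) strict monotonicity on the fat box
  `Y¹`; (W2p)/(W3p) at the window ends; (W4p));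
* `centre_crossingP` — the centre trajectory (`TP + r`: in-step form with vanishing hull term) crosses inside the centre window
  `[ulo 0, uhi 0]` with crossing state in the centre-only box `Z⁰c` ((Wc2)–(Wc4)).

MODEL-lattice rung TL-M3 only; nothing here is a statement about the Navier–Stokes equations.
-/

noncomputable section

-- the sub-problem namespace repeats the summit name by design (D-0017)
set_option linter.dupNamespace false

namespace Summit.NavierStokesRegularity.NavierStokesRegularity.Theorems.TaylorModelV

open Set Finset Metric
open Literature.Analysis.FluidPDE.TaoCascade Literature.Analysis.FluidPDE.TaoCascade.TaylorChain
open Summit.NavierStokesRegularity.NavierStokesRegularity.Theorems.TaylorModelMajorant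
open Summit.NavierStokesRegularity.NavierStokesRegularity.Theorems.TaylorModelVector
open Summit.NavierStokesRegularity.NavierStokesRegularity.Theorems.TaylorModelReadout

variable {cd : CertData} {bx : StepBoxes} {rd : RadiiData} {ro : ReadoutData} {rw : WinData} {φ : Flow}

/-! ### Segments of `NodeStart 0` states, crossings of hull starts, the centre's crossing -/

/-- The segment from the centre `x j s` to a `NodeStart 0` state `y` consists of `NodeStart 1` states, hence lies in the
level-1 hull box (`Cm` linear, `rPl 0 ≤ rPl 1`). [folklore] -/
theorem segment_mem_hull1 (hC : ChainVCore cd bx) {j : ℕ} (hj : j ≤ cd.N₀) {s : ℕ} (hs : s ≤ cd.S j)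
    {y : Fin 4 → ℤ → ℝ} (hy : NodeStart cd bx j s 0 y) {σ : ℝ} (hσ : σ ∈ Icc (0:ℝ) 1) :
    InBox cd (bx.hlo 1 j s) (bx.hhi 1 j s) (cd.x j s + σ • (y - cd.x j s)) := by
  obtain ⟨-, -, hCm, -, -, -, -, -, -, -, -, hr01, hNS, -⟩ := (hC j hj).2.2.1 s hs
  obtain ⟨ξ, hξ, rfl⟩ := hy
  refine hNS 1 _ ⟨σ • ξ, fun i k hk1 hk2 => ?_, ?_⟩
  · rw [Pi.smul_apply, Pi.smul_apply, smul_eq_mul, abs_mul, abs_of_nonneg hσ.1]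
    calc σ * |ξ i k| ≤ 1 * |ξ i k| := by gcongr; exact hσ.2
      _ ≤ bx.rPl 0 j s i k := by rw [one_mul]; exact hξ i k hk1 hk2
      _ ≤ bx.rPl 1 j s i k := (hr01 i k).1
  · rw [add_sub_cancel_left, hCm.map_smul]

/-- **Crossing of a hull start in the last sub-step** (`ReadoutsVP`): for `z` in the level-1 hull box at node `S−1`, the
section value `u ↦ σf (φ(z)(u))` reaches `lev` at a least time `τ` of `[0, h]`, which lies in the LEVEL-1 window
`[ulo 1, uhi 1]`; it is `< lev` before and `> lev` after `τ`, and the crossing state lies in `Z¹ = [zlo 1, zhi 1]`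
((F1′), (R0e), (R6)/(R7) on `Y¹`, (W1), (W2p)–(W4p)). [folklore] -/
theorem lastStep_crossingP (hSN : cd.StageNumerics) (hC : ChainVCore cd bx) (hF : IsFlowPackageV cd bx φ)
    (hRO : ReadoutsVP cd bx rd ro rw) {j : ℕ} (hj : j ≤ cd.N₀) {z : Fin 4 → ℤ → ℝ}
    (hz : InBox cd (bx.hlo 1 j (cd.S j - 1)) (bx.hhi 1 j (cd.S j - 1)) z) :
    ∃ τ, IsLeast {t : ℝ | 0 ≤ t ∧ t ≤ cd.h j (cd.S j - 1) ∧ cd.lev j ≤ cd.σf j (stAt φ j z t)} τ ∧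
      rw.ulo 1 j ≤ τ ∧ τ ≤ rw.uhi 1 j ∧ cd.σf j (stAt φ j z τ) = cd.lev j ∧
      (∀ t, 0 ≤ t → t < τ → cd.σf j (stAt φ j z t) < cd.lev j) ∧
      (∀ t, τ < t → t ≤ cd.h j (cd.S j - 1) → cd.lev j < cd.σf j (stAt φ j z t)) ∧
      InBox cd (rw.zlo 1 j) (rw.zhi 1 j) (stAt φ j z τ) := by
  have hS : 1 ≤ cd.S j := (hC j hj).1
  have hs : cd.S j - 1 < cd.S j := Nat.sub_lt hS Nat.one_pos
  obtain ⟨-, -, hγ, -, hσw, -, -, -, -, -, -, -, -, hR7, -, -, -, -, hW1, hW2, hW3, hW4, -⟩ := hRO j hj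
  obtain ⟨hu10, hu1u0, hu0, hu01, huh⟩ := hW1
  have hlohi : rw.ulo 1 j ≤ rw.uhi 1 j := hu1u0.trans (hu0.trans hu01)
  set hh := cd.h j (cd.S j - 1) with hhh
  -- the trajectory solves on `[0,h]` ((F1′) at an outer-hull start) and stays in `Y¹` ((R6))
  have hz2 : InBox cd (bx.hlo 2 j (cd.S j - 1)) (bx.hhi 2 j (cd.S j - 1)) z := inBox_hull2_of_hull1 hC hj hs.le hz
  obtain ⟨hsol, -⟩ := ((hF.2 j hj).2.2 _ hs).1 z hz2
  have hY : ∀ t ∈ Icc 0 hh, InBox cd (ro.ylo 1 j) (ro.yhi 1 j) (stAt φ j z t) :=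
    fun t ht => stAt_mem_YWP hSN hC hF hRO hj 1 hz ht
  -- the section value is C¹ with derivative `σf (Qb y y) ≥ γ > 0`
  obtain ⟨a, haY, haX⟩ := exists_sigmaCLM hσw
  have hder : ∀ t ∈ Icc 0 hh, HasDerivWithinAt (fun u => cd.σf j (stAt φ j z u))
      (cd.σf j (cd.Qb (stAt φ j z t) (stAt φ j z t))) (Icc 0 hh) t := by
    intro t ht
    have h1 := a.hasFDerivAt.comp_hasDerivWithinAt t (hasDerivWithinAt_toVec_stAt hsol ht)
    have e1 : (⇑a ∘ fun u => toVec cd (stAt φ j z u)) = fun u => cd.σf j (stAt φ j z u) := by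
      funext u; exact (haY _).symm
    rw [e1, haX, ofVec_Qw_self] at h1
    exact h1
  have hcont : ContinuousOn (fun u => cd.σf j (stAt φ j z u)) (Icc 0 hh) := fun t ht => (hder t ht).continuousWithinAt
  have hmono : StrictMonoOn (fun u => cd.σf j (stAt φ j z u)) (Icc 0 hh) := by
    refine strictMonoOn_of_deriv_pos (convex_Icc _ _) hcont ?_
    intro x hx
    rw [interior_Icc] at hx
    rw [((hder x ⟨hx.1.le, hx.2.le⟩).hasDerivAt (Icc_mem_nhds hx.1 hx.2)).deriv]
    exact hγ.trans_le (hR7 _ (hY x ⟨hx.1.le, hx.2.le⟩))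
  -- in-step form at `u ∈ [0,h]`
  have hform : ∀ u, u ∈ Icc 0 hh →
      ∃ (A : Ker) (r : Fin 4 → ℤ → ℝ), InStepKer cd bx j (cd.S j - 1) u A ∧
        AbsLeW cd r (fun i k => bx.J j (cd.S j - 1) i k * u ^ (cd.pdeg + 1)) ∧
        stAt φ j z u = cd.TP j (cd.S j - 1) u + r + kapp cd A (z - cd.x j (cd.S j - 1)) :=
    fun u hu => exists_inStep_repr hSN hC hF hj hs 1 hz hu
  -- signs at the two window ends ((W2p)/(W3p))
  have hlt : cd.σf j (stAt φ j z (rw.ulo 1 j)) < cd.lev j := by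
    obtain ⟨A, r, hA, hr, heq⟩ := hform (rw.ulo 1 j) ⟨hu10, hlohi.trans huh⟩
    rw [heq]; exact hW2 A hA z hz r hr
  have hgt : cd.lev j < cd.σf j (stAt φ j z (rw.uhi 1 j)) := by
    obtain ⟨A, r, hA, hr, heq⟩ := hform (rw.uhi 1 j) ⟨hu10.trans hlohi, huh⟩
    rw [heq]; exact hW3 A hA z hz r hr
  obtain ⟨τ, -, h1, h2, h3, -, -⟩ := G2.exists_isLeast_crossing hlohi (hcont.mono (Icc_subset_Icc hu10 huh))
    (hmono.mono (Icc_subset_Icc hu10 huh)) hlt hgt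
  have hτ0 : 0 ≤ τ := hu10.trans h1.le
  have hτh : τ ≤ hh := h2.trans huh
  have hbefore : ∀ t, 0 ≤ t → t < τ → cd.σf j (stAt φ j z t) < cd.lev j := by
    intro t ht0 htτ
    have h := hmono ⟨ht0, htτ.le.trans hτh⟩ ⟨hτ0, hτh⟩ htτ
    simp only [h3] at h
    exact h
  have hafter : ∀ t, τ < t → t ≤ hh → cd.lev j < cd.σf j (stAt φ j z t) := by
    intro t hτt hth
    have h := hmono ⟨hτ0, hτh⟩ ⟨hτ0.trans hτt.le, hth⟩ hτt
    simp only [h3] at h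
    exact h
  refine ⟨τ, ⟨⟨hτ0, hτh, h3.ge⟩, ?_⟩, h1.le, h2, h3, hbefore, hafter, ?_⟩
  · rintro t ⟨ht0, hth, hlev⟩
    by_contra hlt'
    have := hbefore t ht0 (lt_of_not_ge hlt')
    linarith
  · obtain ⟨A, r, hA, hr, heq⟩ := hform τ ⟨hτ0, hτh⟩
    rw [heq]; exact hW4 τ ⟨h1.le, h2⟩ A hA z hz r hr

/-- **The centre's crossing** (`ReadoutsVP`): if the CENTRE trajectory `φ(x_{S−1})` of the last sub-step crosses at `τ ∈ [0,h]`
(value `lev`, `< lev` before, `> lev` after), then `τ` lies in the centre window `[ulo 0, uhi 0]` and the crossing state in the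
centre-only box `Z⁰c = [zlo 0, zhi 0]` — the centre's states are `TP(u) + r` (in-step form with vanishing hull term), so
(Wc2)–(Wc4) apply. [folklore] -/
theorem centre_crossingP (hSN : cd.StageNumerics) (hC : ChainVCore cd bx) (hF : IsFlowPackageV cd bx φ)
    (hRO : ReadoutsVP cd bx rd ro rw) {j : ℕ} (hj : j ≤ cd.N₀) {τ : ℝ} (hτ0 : 0 ≤ τ) (hτh : τ ≤ cd.h j (cd.S j - 1))
    (hb : ∀ t, 0 ≤ t → t < τ → cd.σf j (stAt φ j (cd.x j (cd.S j - 1)) t) < cd.lev j)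
    (ha : ∀ t, τ < t → t ≤ cd.h j (cd.S j - 1) → cd.lev j < cd.σf j (stAt φ j (cd.x j (cd.S j - 1)) t)) :
    rw.ulo 0 j ≤ τ ∧ τ ≤ rw.uhi 0 j ∧ InBox cd (rw.zlo 0 j) (rw.zhi 0 j) (stAt φ j (cd.x j (cd.S j - 1)) τ) := by
  have hS : 1 ≤ cd.S j := (hC j hj).1
  have hs : cd.S j - 1 < cd.S j := Nat.sub_lt hS Nat.one_pos
  obtain ⟨-, -, -, -, -, -, -, -, -, -, -, -, -, -, -, -, -, -, hW1, -, -, -, hWc2, hWc3, hWc4⟩ := hRO j hj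
  obtain ⟨hu10, hu1u0, hu0, hu01, huh⟩ := hW1
  have hxc : InBox cd (bx.hlo 1 j (cd.S j - 1)) (bx.hhi 1 j (cd.S j - 1)) (cd.x j (cd.S j - 1)) :=
    x_mem_hull hC hj hs.le 1
  -- the centre's states are `TP(u) + r`
  have hform : ∀ u, u ∈ Icc 0 (cd.h j (cd.S j - 1)) → ∃ r : Fin 4 → ℤ → ℝ,
      AbsLeW cd r (fun i k => bx.J j (cd.S j - 1) i k * u ^ (cd.pdeg + 1)) ∧
        stAt φ j (cd.x j (cd.S j - 1)) u = cd.TP j (cd.S j - 1) u + r := by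
    intro u hu
    obtain ⟨A, r, -, hr, heq⟩ := exists_inStep_repr hSN hC hF hj hs 1 hxc hu
    refine ⟨r, hr, ?_⟩
    rw [heq, sub_self, (kapp_linear A).map_zero, add_zero]
  have hlo : rw.ulo 0 j ≤ τ := by
    by_contra hne
    rw [not_le] at hne
    obtain ⟨r, hr, heq⟩ := hform (rw.ulo 0 j) ⟨hu10.trans hu1u0, hu0.trans (hu01.trans huh)⟩
    have h1 := hWc2 r hr
    have h2 := ha _ hne (hu0.trans (hu01.trans huh))
    rw [heq] at h2
    linarith
  have hhi : τ ≤ rw.uhi 0 j := by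
    by_contra hne
    rw [not_le] at hne
    obtain ⟨r, hr, heq⟩ := hform (rw.uhi 0 j) ⟨hu10.trans (hu1u0.trans hu0), hu01.trans huh⟩
    have h1 := hWc3 r hr
    have h2 := hb _ (hu10.trans (hu1u0.trans hu0)) hne
    rw [heq] at h2
    linarith
  obtain ⟨r, hr, heq⟩ := hform τ ⟨hτ0, hτh⟩
  exact ⟨hlo, hhi, by rw [heq]; exact hWc4 τ ⟨hlo, hhi⟩ r hr⟩

end Summit.NavierStokesRegularity.NavierStokesRegularity.Theorems.TaylorModelV

end
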